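import Literature.NumberTheory.EllipticCurves.AnticyclotomicBigGaloisRep
import Mathlib.NumberTheory.Padics.MahlerBasis
import Mathlib.Topology.UniformSpace.HeineCantor
import HarnessLib

/-!
# Route `EisensteinPrimes` (rung K5), crux 2 `GoodLatticeBDPValue`, line `halves` v5, stub
# `stub_noPseudoNull`, road (γ) — part 1/2: the FINITE MAHLER EXPANSION of smooth `p`-primary
# functions `ℤ_p → B` (the co-induced module `BigRepModule R p B = B ⊗ Λ^*`)
# (helper for stmt-BirchSwinnertonDyer-19032)

Cell `bsd-eis`, seat `bsd-eis-k5-c2` (gen 8). Planner RULINGS L36 (2) / L45 (3) / L50 (3) name the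
KERNEL PART of road (γ) — Rubin 1991 Thm. 5.3 (v) without `p ∤ h_K` through Greenberg 2016
Prop. 4.1.1 (c) for the twist deformation `𝐃 = twistDeformation S hS κ₁ κ₂ ρ₀` on
`IndModule₂ ℤ_[p] p A` (`Greenberg2006/TwistDeformation.lean`) —; its first named gap is
`IsCofree Λ₂ 𝐃` ("Iwasawa–Serre iso + Pontryagin duality", TwistDeformation.lean module docstring
"GAP"), closed in part 2/2 (`EisensteinPrimesTwistDeformationCofree.lean`). THIS FILE is the
one-variable engine, for the tree's module `BigRepModule R p B` of smooth `p`-primary functions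
`ℤ_p → B` with its `R⟦T⟧`-structure `T ↦ τ₁ - 1` (`AnticyclotomicBigGaloisRep.lean`):

* `shiftSubOne_pow_apply` — `(τ₁ - 1)^k` is the `k`-th iterated forward difference (Mathlib `fwdDiff`);
  `apply_natCast_eq_sum` — Gregory–Newton on `ℕ ⊂ ℤ_p`; `eq_zero_of_forall_shiftSubOne_pow_apply_zero`
  — a smooth function with all moments `((τ₁ - 1)^k Φ)(0) = 0` vanishes (Newton on `ℕ`, local
  constancy); `powerSeries_smul_apply_eq_sum` — the `R⟦T⟧`-action pointwise as a finite sum.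
* `binom hB i : B →+ BigRepModule R p B`, `b ↦ (x ↦ binom(x, i) • b)` — the MAHLER ELEMENTS (Mathlib
  `Ring.choose` on the binomial ring `ℤ_[p]`; smooth on torsion values by the uniform continuity of
  `PadicInt.continuous_choose` on the compact `ℤ_p`), for a `p`-primary `ℤ_p`-module of values `B`;
  Pascal `shiftSubOne_binom_succ`; the moments `shiftSubOne_pow_binom_apply_zero` (`= [a = i] b`:
  dual to `Tᵃ`); and the TERMINATING Mahler expansion `eq_sum_binom`:
  `Φ = ∑_{i<N} binom i (((τ₁ - 1)^i Φ)(0))` whenever `(τ₁ - 1)^N Φ = 0`.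

Elementary and unconditional; definitions with bodies and theorems only; no named fact, no `sorry`.
HONEST FRAMING: closes nothing by itself (`--supports`). References: K. Mahler, *An interpolation
series for continuous functions of a p-adic variable*, J. reine angew. Math. 199 (1958); P. Colmez,
*Fonctions d'une variable p-adique*, Astérisque 330 (2010) §1.2.1 (Mathlib `MahlerBasis.lean`);
[SkinnerUrban2014] Prop. 3.2.3 (`Λ^* = lim Maps(Γ/Γ^{pⁿ}, ·)`); [Castella2018] §2.2 (`1 + T ↦ γ`).
-/

set_option autoImplicit false
set_option linter.dupNamespace false

noncomputable section

open scoped Classical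
open Finset PowerSeries
open Literature.NumberTheory.EllipticCurves

namespace Summit.BirchSwinnertonDyer.BirchSwinnertonDyer.Theorems.TwistDeformationCofree

/-! ## §1 One variable: evaluation, iterated differences, Gregory–Newton, vanishing of moments -/

section OneVar

variable {R : Type*} [CommRing R] {p : ℕ} [Fact p.Prime] {B : Type*} [AddCommGroup B] [Module R B]

variable (R) in
/-- Evaluation of a smooth `p`-primary function at a point of `ℤ_p`, as an `R`-linear map
`Maps(Γ, B) → B` (the counit of the co-induction at `γ^x`). [cite: SkinnerUrban2014, §3.1.3 and proof of Prop. 3.2.3 (Λ^* = lim Hom(ℤ[Gal(F_n/F)], ·))] -/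
def evalₗ (x : ℤ_[p]) : BigRepModule R p B →ₗ[R] B where
  toFun Φ := Φ x
  map_add' _ _ := rfl
  map_smul' _ _ := rfl

/-- Unfolding `evalₗ`. [cite: SkinnerUrban2014, §3.1.3] -/
@[simp] theorem evalₗ_apply (x : ℤ_[p]) (Φ : BigRepModule R p B) : evalₗ R x Φ = Φ x := rfl

/-- Finite sums of smooth functions are computed pointwise. [folklore] -/
theorem sum_apply {ι : Type*} (s : Finset ι) (Φ : ι → BigRepModule R p B) (x : ℤ_[p]) :
    (∑ i ∈ s, Φ i) x = ∑ i ∈ s, Φ i x := by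
  rw [← evalₗ_apply (R := R) x, map_sum]
  rfl

/-- **Powers of `T = τ₁ - 1` are iterated forward differences**: `((τ₁ - 1)^k Φ)(x) = Δ₁^[k] Φ (x)`
(Mathlib `fwdDiff` with step `1`). [cite: Castella2018, §2.2 (ℤ_p[[T]] = Λ via 1 + T ↦ γ)] -/
theorem shiftSubOne_pow_apply (k : ℕ) (Φ : BigRepModule R p B) (x : ℤ_[p]) :
    ((BigRepModule.shiftSubOne ^ k : BigRepModule R p B →ₗ[R] BigRepModule R p B) Φ) x =
      (fwdDiff (1 : ℤ_[p]))^[k] (⇑Φ) x := by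
  induction k generalizing x with
  | zero => simp only [pow_zero, Module.End.one_apply, Function.iterate_zero, id_eq]
  | succ k ih =>
    rw [pow_succ', Module.End.mul_apply, BigRepModule.shiftSubOne_apply, ih, ih,
      Function.iterate_succ_apply']
    rfl

/-- **Gregory–Newton on `ℕ ⊂ ℤ_p`**: `Φ(n) = ∑_{k ≤ n} (n choose k) · ((τ₁ - 1)^k Φ)(0)`
(Mathlib `shift_eq_sum_fwdDiff_iter`). [folklore] -/
theorem apply_natCast_eq_sum (Φ : BigRepModule R p B) (n : ℕ) :
    Φ (n : ℤ_[p]) = ∑ k ∈ range (n + 1),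
      n.choose k • ((BigRepModule.shiftSubOne ^ k : BigRepModule R p B →ₗ[R] BigRepModule R p B) Φ) 0 := by
  have h := shift_eq_sum_fwdDiff_iter (1 : ℤ_[p]) (⇑Φ) n 0
  rw [zero_add, nsmul_eq_mul, mul_one] at h
  rw [h]
  exact sum_congr rfl fun k _ ↦ by rw [shiftSubOne_pow_apply]

/-- **A smooth `p`-primary function all of whose moments `((τ₁ - 1)^k Φ)(0)` vanish is zero**: by
Gregory–Newton it vanishes on `ℕ`, and it is locally constant while `x ≡ x mod pⁿ ∈ ℕ`. (Dually:
the augmentation-ideal powers `(p, T)`-adically separate `Λ`.) [folklore] -/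
theorem eq_zero_of_forall_shiftSubOne_pow_apply_zero (Φ : BigRepModule R p B)
    (h : ∀ k : ℕ,
      ((BigRepModule.shiftSubOne ^ k : BigRepModule R p B →ₗ[R] BigRepModule R p B) Φ) 0 = 0) :
    Φ = 0 := by
  obtain ⟨n, hn⟩ := Φ.exists_level
  ext x
  rw [BigRepModule.zero_apply, hn x ((x.appr n : ℕ) : ℤ_[p]) (PadicInt.appr_spec n x),
    apply_natCast_eq_sum]
  exact sum_eq_zero fun k _ ↦ by rw [h, smul_zero]

/-- **The `R⟦T⟧`-action on the co-induced module, pointwise**: if `(τ₁ - 1)^N Φ = 0` then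
`(f • Φ)(x) = ∑_{i<N} coeff_i(f) • ((τ₁ - 1)^i Φ)(x)` (the action through `R[T]/(Tᴺ)`,
`BigRepModule.powerSeries_smul_def` + `LocNil.IsLocNil.smulFun_apply`).
[cite: Castella2018, §2.2 (ℤ_p[[T]] = Λ via 1 + T ↦ γ)] -/
theorem powerSeries_smul_apply_eq_sum {N : ℕ} {Φ : BigRepModule R p B}
    (hN : ((BigRepModule.shiftSubOne ^ N : BigRepModule R p B →ₗ[R] BigRepModule R p B) Φ) = 0)
    (f : PowerSeries R) (x : ℤ_[p]) :
    (f • Φ) x = ∑ i ∈ range N,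
      coeff i f • ((BigRepModule.shiftSubOne ^ i : BigRepModule R p B →ₗ[R] BigRepModule R p B) Φ) x := by
  rw [BigRepModule.powerSeries_smul_def, LocNil.IsLocNil.smulFun_apply _ f hN, LocNil.evalT,
    sum_apply]
  simp only [BigRepModule.smul_apply]

/-- Every smooth `p`-primary function is killed by a power of `p` (as an element).
[cite: SkinnerUrban2014, §3.1.3 and proof of Prop. 3.2.3 (Λ^* = lim Hom(ℤ[Gal(F_n/F)], ·))] -/
theorem exists_pow_smul_eq_zero (Ψ : BigRepModule R p B) : ∃ k : ℕ, p ^ k • Ψ = 0 := by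
  obtain ⟨k, hk⟩ := Ψ.exists_torsion
  exact ⟨k, by ext x; rw [BigRepModule.nsmul_apply, hk, BigRepModule.zero_apply]⟩

end OneVar

/-! ## §2 One variable: the binomial (Mahler) functions `x ↦ binom(x, i) • b` -/

section Binom

variable {R : Type*} [CommRing R] {p : ℕ} [Fact p.Prime] {B : Type*} [AddCommGroup B] [Module R B]
  [Module ℤ_[p] B]

/-- **The Mahler functions are smooth on torsion values**: for `p^k b = 0` the function
`x ↦ binom(x, i) • b` on `ℤ_p` is constant on the cosets of some `pⁿℤ_p` — `x ↦ binom(x, i)` is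
(uniformly) continuous on the compact group `ℤ_p` (Mathlib `PadicInt.continuous_choose`), so
`binom(x, i) ≡ binom(y, i) (mod p^k)` for `x ≡ y (mod pⁿ)`. [folklore] -/
theorem exists_isSmoothOfLevel_choose_smul {b : B} {k : ℕ} (hb : p ^ k • b = 0) (i : ℕ) :
    ∃ n : ℕ, IsSmoothOfLevel p B n (fun x : ℤ_[p] ↦ Ring.choose x i • b) := by
  have huc : UniformContinuous (mahler (p := p) i) :=
    CompactSpace.uniformContinuous_of_continuous (mahler (p := p) i).continuous
  rw [Metric.uniformContinuous_iff] at huc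
  obtain ⟨δ, hδ, hδ'⟩ := huc ((p : ℝ) ^ (-(k : ℤ)))
    (zpow_pos (by exact_mod_cast (Fact.out : p.Prime).pos) _)
  obtain ⟨n, hn⟩ := PadicInt.exists_pow_neg_lt p hδ
  refine ⟨n, fun x y hxy ↦ ?_⟩
  have hdist : dist x y < δ := by
    rw [dist_eq_norm]
    exact lt_of_le_of_lt ((PadicInt.norm_le_pow_iff_mem_span_pow _ _).mpr hxy) hn
  have hlt := hδ' hdist
  rw [dist_eq_norm, mahler_apply, mahler_apply] at hlt
  have hmem : Ring.choose x i - Ring.choose y i ∈ Ideal.span {(p : ℤ_[p]) ^ k} :=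
    (PadicInt.norm_le_pow_iff_mem_span_pow _ _).mp hlt.le
  obtain ⟨w, hw⟩ := Ideal.mem_span_singleton'.mp hmem
  show Ring.choose x i • b = Ring.choose y i • b
  rw [← sub_eq_zero, ← sub_smul, ← hw, mul_smul, ← Nat.cast_pow, Nat.cast_smul_eq_nsmul, hb,
    smul_zero]

/-- The Mahler function `x ↦ binom(x, i) • b` is a smooth `p`-primary function when `B` is
`p`-primary. [folklore] -/
theorem choose_smul_mem (hB : ∀ b : B, ∃ k : ℕ, p ^ k • b = 0) (i : ℕ) (b : B) :
    (fun x : ℤ_[p] ↦ Ring.choose x i • b) ∈ bigRepSubmodule R p B := by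
  obtain ⟨k, hk⟩ := hB b
  exact ⟨exists_isSmoothOfLevel_choose_smul hk i,
    ⟨k, fun x ↦ by
      show p ^ k • (Ring.choose x i • b) = 0
      rw [smul_comm, hk, smul_zero]⟩⟩

/-- **The `i`-th binomial (Mahler) element `x ↦ binom(x, i) • b` of the co-induced module**, additive
in `b` (for a `p`-primary `ℤ_p`-module of values `B`): the dual basis of `Tⁱ ∈ Λ = ℤ_p⟦T⟧` under
the moment pairing (`shiftSubOne_pow_binom_apply_zero`). [folklore] -/
def binom (hB : ∀ b : B, ∃ k : ℕ, p ^ k • b = 0) (i : ℕ) : B →+ BigRepModule R p B where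
  toFun b := BigRepModule.mk _ (choose_smul_mem (R := R) hB i b)
  map_zero' := by
    ext x
    rw [BigRepModule.mk_apply, smul_zero, BigRepModule.zero_apply]
  map_add' b b' := by
    ext x
    rw [BigRepModule.mk_apply, BigRepModule.add_apply, BigRepModule.mk_apply, BigRepModule.mk_apply,
      smul_add]

/-- Unfolding `binom`: `(binom i b)(x) = binom(x, i) • b`. [folklore] -/
@[simp] theorem binom_apply (hB : ∀ b : B, ∃ k : ℕ, p ^ k • b = 0) (i : ℕ) (b : B) (x : ℤ_[p]) :
    (binom (R := R) hB i b) x = Ring.choose x i • b := rfl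

/-- **Pascal**: `(τ₁ - 1)` lowers the index, `(τ₁ - 1)(binom (i+1) b) = binom i b`
(`binom(x+1, i+1) - binom(x, i+1) = binom(x, i)`, Mathlib `Ring.choose_succ_succ`). [folklore] -/
theorem shiftSubOne_binom_succ (hB : ∀ b : B, ∃ k : ℕ, p ^ k • b = 0) (i : ℕ) (b : B) :
    BigRepModule.shiftSubOne (binom (R := R) hB (i + 1) b) = binom (R := R) hB i b := by
  ext x
  rw [BigRepModule.shiftSubOne_apply, binom_apply, binom_apply, binom_apply, Ring.choose_succ_succ,
    add_smul, add_sub_cancel_right]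

/-- `(τ₁ - 1)` kills the constant Mahler element `binom 0 b = (x ↦ b)`. [folklore] -/
theorem shiftSubOne_binom_zero (hB : ∀ b : B, ∃ k : ℕ, p ^ k • b = 0) (b : B) :
    BigRepModule.shiftSubOne (binom (R := R) hB 0 b) = 0 := by
  ext x
  rw [BigRepModule.shiftSubOne_apply, binom_apply, binom_apply, Ring.choose_zero_right,
    Ring.choose_zero_right, sub_self, BigRepModule.zero_apply]

/-- Iterating Pascal: `(τ₁ - 1)^a (binom i b) = binom (i - a) b` for `a ≤ i`, and `0` for `a > i`.
[folklore] -/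
theorem shiftSubOne_pow_binom (hB : ∀ b : B, ∃ k : ℕ, p ^ k • b = 0) (a i : ℕ) (b : B) :
    (BigRepModule.shiftSubOne ^ a : BigRepModule R p B →ₗ[R] BigRepModule R p B) (binom hB i b) =
      if a ≤ i then binom (R := R) hB (i - a) b else 0 := by
  induction a generalizing i with
  | zero => simp only [pow_zero, Module.End.one_apply, zero_le, if_true, Nat.sub_zero]
  | succ a ih =>
    rw [pow_succ, Module.End.mul_apply]
    cases i with
    | zero =>
      rw [shiftSubOne_binom_zero, map_zero, if_neg (Nat.not_succ_le_zero a)]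
    | succ i =>
      rw [shiftSubOne_binom_succ, ih, Nat.succ_sub_succ]
      exact if_congr Nat.succ_le_succ_iff.symm rfl rfl

/-- The value of a Mahler element at `0`: `(binom i b)(0) = b` if `i = 0`, else `0`
(`binom(0, i) = [i = 0]`, Mathlib `Ring.choose_zero_ite`). [folklore] -/
theorem binom_apply_zero (hB : ∀ b : B, ∃ k : ℕ, p ^ k • b = 0) (i : ℕ) (b : B) :
    (binom (R := R) hB i b) 0 = if i = 0 then b else 0 := by
  rw [binom_apply, Ring.choose_zero_ite, ite_smul, one_smul, zero_smul]

/-- **The moments of the Mahler elements**: `((τ₁ - 1)^a (binom i b))(0) = b` if `a = i`, else `0` —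
the Mahler elements are dual to the monomials `Tᵃ`. [folklore] -/
theorem shiftSubOne_pow_binom_apply_zero (hB : ∀ b : B, ∃ k : ℕ, p ^ k • b = 0) (a i : ℕ) (b : B) :
    ((BigRepModule.shiftSubOne ^ a : BigRepModule R p B →ₗ[R] BigRepModule R p B) (binom hB i b)) 0 =
      if a = i then b else 0 := by
  rw [shiftSubOne_pow_binom]
  by_cases hai : a ≤ i
  · rw [if_pos hai, binom_apply_zero]
    by_cases h : a = i
    · subst h
      rw [if_pos (Nat.sub_self a), if_pos rfl]
    · rw [if_neg (by omega), if_neg h]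
  · rw [if_neg hai, BigRepModule.zero_apply, if_neg (by omega)]

/-- **Finite Mahler expansion of a smooth `p`-primary function**: if `(τ₁ - 1)^N Φ = 0` then
`Φ = ∑_{i<N} binom i (((τ₁ - 1)^i Φ)(0))` — the difference has all moments zero. (For a locally
constant `p^k`-torsion function the Mahler expansion TERMINATES.) [folklore] -/
theorem eq_sum_binom (hB : ∀ b : B, ∃ k : ℕ, p ^ k • b = 0) {N : ℕ} {Φ : BigRepModule R p B}
    (hN : ((BigRepModule.shiftSubOne ^ N : BigRepModule R p B →ₗ[R] BigRepModule R p B) Φ) = 0) :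
    Φ = ∑ i ∈ range N, binom (R := R) hB i
      (((BigRepModule.shiftSubOne ^ i : BigRepModule R p B →ₗ[R] BigRepModule R p B) Φ) 0) := by
  rw [← sub_eq_zero]
  refine eq_zero_of_forall_shiftSubOne_pow_apply_zero _ fun a ↦ ?_
  rw [map_sub, BigRepModule.sub_apply, map_sum, sum_apply]
  simp_rw [shiftSubOne_pow_binom_apply_zero]
  rw [sum_ite_eq]
  by_cases ha : a ∈ range N
  · rw [if_pos ha, sub_self]
  · rw [if_neg ha, sub_zero]
    rw [mem_range, not_lt] at ha
    rw [← Nat.sub_add_cancel ha, pow_add, Module.End.mul_apply, hN, LinearMap.map_zero,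
      BigRepModule.zero_apply]

end Binom

end Summit.BirchSwinnertonDyer.BirchSwinnertonDyer.Theorems.TwistDeformationCofree

end
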